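import Literature.NumberTheory.Sieve.SmoothParityMajorPoint
import HarnessLib

/-!
# Parity-class friable ternary counts: the three profile sums at one major-arc point

Topic `Literature/NumberTheory/Sieve`, namespace `Literature.NumberTheory.Sieve.SmoothArcs`; the PROVED sequel of
`SmoothParityMajorPoint` in the circle-method engine of `SmoothParityTernary` ([Harper2016, §5];
[LagariasSoundararajan2012]).  Notation as there: `α = α(x,y)`, `𝓜 = x^α ζ(α,y)/√(2πφ₂(α,y))`, `X_i = x/e_i`,
`Mv_i = e_i^{−α}𝓜`, `W`-class profiles `c_i` with `S_i = Σ_ℓ‖c_{i,ℓ}‖(1+|ℓ|)`, `‖c_i‖_W = profileNorm c_i`.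

* `parity_major_point`: at `θ = a/k + β` with `|β|x ≤ Λ/2` (`k ≥ 1` `y`-friable, ANY numerator `a`), for the two
  odd-class sums `V_i = classProfileSum X_i y 2 1 c_i` (`i = 1,2`, dilations `d₁, d₂`, sign `σ = ±1` on the second,
  `d_iX_i ≤ x`) and the free sum `V₃ = classProfileSum X₃ y 1 0 c₃` (`Λ ≤ X_i`):
  `‖V₁(d₁θ)V₂(σd₂θ)V̄₃(θ) − LF₁LF₂L̄F₃ · M₁(d₁β)M₂(σd₂β)M̄₃(β)‖`
  `≤ 331 η Π_i(Hc_iMv_iS_i)/Π_i(1+|λ_i|) + 3(Π_i(11Hc_iMv_iS_i + F_i) − Π_i 11Hc_iMv_iS_i)`,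
  `λ₁ = d₁βX₁`, `λ₂ = d₂βX₂`, `λ₃ = βX₃`, `LF₁ = classLocalFactor α 2 1 k (d₁a)`, `LF₂ = classLocalFactor α 2 1 k (σd₂a)`,
  `LF₃ = classLocalFactor α 1 0 k a` (so that `Σ_{(a,k)=1} LF₁LF₂L̄F₃ = paritySingTerm α σ d₁ d₂ k`), `Hc_i` the
  corresponding `classLocalHc` (`‖LF_i‖ ≤ Hc_i`), `M_i = profileModelSum c_i Mv_i X_i α`, and the FLAT errors
  `F_i = Hc_iMv_i(12(1+Λ)S_i/X_i + 16‖c_i‖_W/Λ³) + (2k C_F X_i^{1/2+ε₀}(2k)^{ε₀}(1+Λ)³ + 16Ψ(X_i,y)/Λ³)‖c_i‖_W`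
  (three applications of `classProfileSum_major_point` and the abstract product step `norm_triple_sub_triple_le`).

The DECAYING error is summable over the points `β` of an arc with two of the three factors `1/(1+|λ_i|)`; the FLAT
error is small pointwise (`(1+Λ)/X_i`, `1/Λ³` against `‖c_i‖_W`, and the GRH saving `X_i^{1/2+ε₀}` against `Mv_i`).
Deliberately NOT here: the summation over the major arcs (sequel).

## References

* A. J. Harper, Compositio Math. 152 (2016), §2.2, §5 [Harper2016].
* J. C. Lagarias, K. Soundararajan, Proc. LMS 104 (2012) [LagariasSoundararajan2012].
-/

noncomputable section

open Finset Real Complex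
open scoped FourierTransform

namespace Literature.NumberTheory.Sieve

namespace SmoothArcs

open TwistedWeight

/-- **The three parity-class profile sums at a major-arc point.**  With the data and the inputs (hW) (window at
precision `η ∈ [0,1]` for the scalings `e' ≤ E`, `|λ| ≤ Λ`) and (hF) (currency at `(ε₀, C_F)`) of
`classProfileSum_major_point`, scalings `1 ≤ e_i ≤ x` with `Λ ≤ X_i = x/e_i`, dilations `d₁, d₂` with `d_iX_i ≤ x`, a sign
`σ = ±1`, a `y`-friable `k ≥ 1` with `e_i(2k)² ≤ E` (`i = 1,2`), `e₃k² ≤ E`, ANY numerator `a`, `W`-class profiles `c_i`,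
and `|β|x ≤ Λ/2`: writing `θ = a/k + β`, `α = α(x,y)`, `Mv_i = e_i^{−α}𝓜`, `S_i = Σ_ℓ‖c_{i,ℓ}‖(1+|ℓ|)`,
`Hc₁ = classLocalHc α 2 1 k (d₁a)`, `Hc₂ = classLocalHc α 2 1 k (σd₂a)`, `Hc₃ = classLocalHc α 1 0 k a`,
`λ₁ = d₁βX₁`, `λ₂ = d₂βX₂`, `λ₃ = βX₃`:
`‖V₁(d₁θ) V₂(σd₂θ) conj V₃(θ) − LF₁LF₂conj LF₃ · M₁(d₁β)M₂(σd₂β)conj M₃(β)‖`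
`≤ 331 η Π_i(Hc_i Mv_i S_i) / Π_i(1+|λ_i|) + 3 (Π_i(11 Hc_iMv_iS_i + F_i) − Π_i 11 Hc_iMv_iS_i)`,
`F_i = Hc_iMv_i(12(1+Λ)S_i/X_i + 16‖c_i‖_W/Λ³) + (2k C_F X_i^{1/2+ε₀}(2k)^{ε₀}(1+Λ)³ + 16Ψ(X_i,y)/Λ³)‖c_i‖_W`
(`V₁, V₂` the odd-class sums `classProfileSum X_i y 2 1 c_i`, `V₃ = classProfileSum X₃ y 1 0 c₃`, `LF` the class local
factors, `M_i = profileModelSum c_i Mv_i X_i α`). [cite: Harper2016, §5] -/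
theorem parity_major_point {x : ℝ} {y : ℕ} (hx : 1 < x) (hy : 2 ≤ y) (hα1 : saddlePoint x y ≤ 1)
    {Λ η E ε₀ C_F : ℝ} (hΛ : 0 < Λ) (hη0 : 0 ≤ η) (hη1 : η ≤ 1) (hε₀ : 0 < ε₀) (hC : 0 ≤ C_F)
    (hW : ∀ e' : ℕ, 1 ≤ e' → (e' : ℝ) ≤ E → ∀ lam : ℝ, |lam| ≤ Λ →
      ‖(∑ n ∈ Nat.smoothNumbersUpTo ⌊x / e'⌋₊ (y + 1), twistWeight lam (n / (x / e'))) -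
          ((((e' : ℝ) ^ (-saddlePoint x y) * (x ^ saddlePoint x y * smoothZeta (saddlePoint x y) y /
              Real.sqrt (2 * Real.pi * saddlePhi₂ (saddlePoint x y) y)) : ℝ)) : ℂ) * twistMellin lam (saddlePoint x y)‖ ≤
        (e' : ℝ) ^ (-saddlePoint x y) * (η * (x ^ saddlePoint x y * smoothZeta (saddlePoint x y) y /
          Real.sqrt (2 * Real.pi * saddlePhi₂ (saddlePoint x y) y)) / (1 + |lam|)))
    (hF : ∀ (q : ℕ) (χ : DirichletCharacter ℂ q), q ≠ 0 → χ ≠ 1 → ∀ (y : ℕ) (X lam : ℝ), 1 ≤ X →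
      ‖∑ n ∈ Nat.smoothNumbersUpTo ⌊X⌋₊ (y + 1), χ (n : ZMod q) * twistWeight lam (n / X)‖ ≤
        C_F * (1 + |lam|) ^ 3 * X ^ (1 / 2 + ε₀) * (q : ℝ) ^ ε₀)
    {e₁ e₂ e₃ d₁ d₂ k : ℕ} {σ : ℤ} (hσ : σ = 1 ∨ σ = -1) (he₁ : 1 ≤ e₁) (he₂ : 1 ≤ e₂) (he₃ : 1 ≤ e₃)
    (hex₁ : (e₁ : ℝ) ≤ x) (hex₂ : (e₂ : ℝ) ≤ x) (hex₃ : (e₃ : ℝ) ≤ x)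
    (hΛ₁ : Λ ≤ x / e₁) (hΛ₂ : Λ ≤ x / e₂) (hΛ₃ : Λ ≤ x / e₃)
    (hd₁ : (d₁ : ℝ) * (x / e₁) ≤ x) (hd₂ : (d₂ : ℝ) * (x / e₂) ≤ x)
    (hk : 1 ≤ k) (hkS : k ∈ Nat.smoothNumbers (y + 1))
    (hE₁ : ((e₁ * (2 * k) ^ 2 : ℕ) : ℝ) ≤ E) (hE₂ : ((e₂ * (2 * k) ^ 2 : ℕ) : ℝ) ≤ E)
    (hE₃ : ((e₃ * k ^ 2 : ℕ) : ℝ) ≤ E)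
    (a : ℕ) {c₁ c₂ c₃ : ℤ → ℂ} (hc₁ : Summable (fun ℓ : ℤ => ‖c₁ ℓ‖ * (1 + |(ℓ : ℝ)|) ^ 3))
    (hc₂ : Summable (fun ℓ : ℤ => ‖c₂ ℓ‖ * (1 + |(ℓ : ℝ)|) ^ 3))
    (hc₃ : Summable (fun ℓ : ℤ => ‖c₃ ℓ‖ * (1 + |(ℓ : ℝ)|) ^ 3))
    {β : ℝ} (hβ : |β| * x ≤ Λ / 2) :
    ‖classProfileSum (x / e₁) y 2 1 c₁ ((d₁ : ℝ) * ((a : ℝ) / k + β)) *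
          classProfileSum (x / e₂) y 2 1 c₂ ((σ : ℝ) * d₂ * ((a : ℝ) / k + β)) *
          starRingEnd ℂ (classProfileSum (x / e₃) y 1 0 c₃ ((a : ℝ) / k + β)) -
        classLocalFactor (saddlePoint x y) 2 1 k (d₁ * a) * classLocalFactor (saddlePoint x y) 2 1 k (σ * (d₂ * a)) *
            starRingEnd ℂ (classLocalFactor (saddlePoint x y) 1 0 k a) *
          (profileModelSum c₁ ((e₁ : ℝ) ^ (-saddlePoint x y) * (x ^ saddlePoint x y * smoothZeta (saddlePoint x y) y /
            Real.sqrt (2 * Real.pi * saddlePhi₂ (saddlePoint x y) y))) (x / e₁) (saddlePoint x y) ((d₁ : ℝ) * β) *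
            profileModelSum c₂ ((e₂ : ℝ) ^ (-saddlePoint x y) * (x ^ saddlePoint x y * smoothZeta (saddlePoint x y) y /
            Real.sqrt (2 * Real.pi * saddlePhi₂ (saddlePoint x y) y))) (x / e₂) (saddlePoint x y) ((σ : ℝ) * d₂ * β) *
            starRingEnd ℂ (profileModelSum c₃ ((e₃ : ℝ) ^ (-saddlePoint x y) * (x ^ saddlePoint x y * smoothZeta (saddlePoint x y) y /
            Real.sqrt (2 * Real.pi * saddlePhi₂ (saddlePoint x y) y))) (x / e₃) (saddlePoint x y) β))‖ ≤
      331 * η * (classLocalHc (saddlePoint x y) 2 1 k (d₁ * a) * (((e₁ : ℝ) ^ (-saddlePoint x y) * (x ^ saddlePoint x y * smoothZeta (saddlePoint x y) y /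
            Real.sqrt (2 * Real.pi * saddlePhi₂ (saddlePoint x y) y))) * (∑' ℓ : ℤ, ‖c₁ ℓ‖ * (1 + |(ℓ : ℝ)|)))) *
            (classLocalHc (saddlePoint x y) 2 1 k (σ * (d₂ * a)) * (((e₂ : ℝ) ^ (-saddlePoint x y) * (x ^ saddlePoint x y * smoothZeta (saddlePoint x y) y /
            Real.sqrt (2 * Real.pi * saddlePhi₂ (saddlePoint x y) y))) * (∑' ℓ : ℤ, ‖c₂ ℓ‖ * (1 + |(ℓ : ℝ)|)))) *
            (classLocalHc (saddlePoint x y) 1 0 k a * (((e₃ : ℝ) ^ (-saddlePoint x y) * (x ^ saddlePoint x y * smoothZeta (saddlePoint x y) y /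
            Real.sqrt (2 * Real.pi * saddlePhi₂ (saddlePoint x y) y))) * (∑' ℓ : ℤ, ‖c₃ ℓ‖ * (1 + |(ℓ : ℝ)|)))) *
          (1 / (1 + |(d₁ : ℝ) * β * (x / e₁)|) * (1 / (1 + |(d₂ : ℝ) * β * (x / e₂)|)) *
            (1 / (1 + |β * (x / e₃)|))) +
        3 * ((11 * (classLocalHc (saddlePoint x y) 2 1 k (d₁ * a) * (((e₁ : ℝ) ^ (-saddlePoint x y) * (x ^ saddlePoint x y * smoothZeta (saddlePoint x y) y /
            Real.sqrt (2 * Real.pi * saddlePhi₂ (saddlePoint x y) y))) * (∑' ℓ : ℤ, ‖c₁ ℓ‖ * (1 + |(ℓ : ℝ)|)))) +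
              (classLocalHc (saddlePoint x y) 2 1 k (d₁ * a) * ((e₁ : ℝ) ^ (-saddlePoint x y) * (x ^ saddlePoint x y * smoothZeta (saddlePoint x y) y /
            Real.sqrt (2 * Real.pi * saddlePhi₂ (saddlePoint x y) y))) *
            (12 * (1 + Λ) * (∑' ℓ : ℤ, ‖c₁ ℓ‖ * (1 + |(ℓ : ℝ)|)) / (x / e₁) + 16 * profileNorm c₁ / Λ ^ 3) +
          ((2 * k : ℝ) * C_F * (x / e₁) ^ (1 / 2 + ε₀) * (2 * k : ℝ) ^ ε₀ * (1 + Λ) ^ 3 +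
            16 * ((Nat.smoothNumbersUpTo ⌊x / e₁⌋₊ (y + 1)).card : ℝ) / Λ ^ 3) * profileNorm c₁)) *
            (11 * (classLocalHc (saddlePoint x y) 2 1 k (σ * (d₂ * a)) * (((e₂ : ℝ) ^ (-saddlePoint x y) * (x ^ saddlePoint x y * smoothZeta (saddlePoint x y) y /
            Real.sqrt (2 * Real.pi * saddlePhi₂ (saddlePoint x y) y))) * (∑' ℓ : ℤ, ‖c₂ ℓ‖ * (1 + |(ℓ : ℝ)|)))) +
              (classLocalHc (saddlePoint x y) 2 1 k (σ * (d₂ * a)) * ((e₂ : ℝ) ^ (-saddlePoint x y) * (x ^ saddlePoint x y * smoothZeta (saddlePoint x y) y /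
            Real.sqrt (2 * Real.pi * saddlePhi₂ (saddlePoint x y) y))) *
            (12 * (1 + Λ) * (∑' ℓ : ℤ, ‖c₂ ℓ‖ * (1 + |(ℓ : ℝ)|)) / (x / e₂) + 16 * profileNorm c₂ / Λ ^ 3) +
          ((2 * k : ℝ) * C_F * (x / e₂) ^ (1 / 2 + ε₀) * (2 * k : ℝ) ^ ε₀ * (1 + Λ) ^ 3 +
            16 * ((Nat.smoothNumbersUpTo ⌊x / e₂⌋₊ (y + 1)).card : ℝ) / Λ ^ 3) * profileNorm c₂)) *
            (11 * (classLocalHc (saddlePoint x y) 1 0 k a * (((e₃ : ℝ) ^ (-saddlePoint x y) * (x ^ saddlePoint x y * smoothZeta (saddlePoint x y) y /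
            Real.sqrt (2 * Real.pi * saddlePhi₂ (saddlePoint x y) y))) * (∑' ℓ : ℤ, ‖c₃ ℓ‖ * (1 + |(ℓ : ℝ)|)))) +
              (classLocalHc (saddlePoint x y) 1 0 k a * ((e₃ : ℝ) ^ (-saddlePoint x y) * (x ^ saddlePoint x y * smoothZeta (saddlePoint x y) y /
            Real.sqrt (2 * Real.pi * saddlePhi₂ (saddlePoint x y) y))) *
            (12 * (1 + Λ) * (∑' ℓ : ℤ, ‖c₃ ℓ‖ * (1 + |(ℓ : ℝ)|)) / (x / e₃) + 16 * profileNorm c₃ / Λ ^ 3) +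
          ((2 * k : ℝ) * C_F * (x / e₃) ^ (1 / 2 + ε₀) * (2 * k : ℝ) ^ ε₀ * (1 + Λ) ^ 3 +
            16 * ((Nat.smoothNumbersUpTo ⌊x / e₃⌋₊ (y + 1)).card : ℝ) / Λ ^ 3) * profileNorm c₃)) -
          11 * (classLocalHc (saddlePoint x y) 2 1 k (d₁ * a) * (((e₁ : ℝ) ^ (-saddlePoint x y) * (x ^ saddlePoint x y * smoothZeta (saddlePoint x y) y /
            Real.sqrt (2 * Real.pi * saddlePhi₂ (saddlePoint x y) y))) * (∑' ℓ : ℤ, ‖c₁ ℓ‖ * (1 + |(ℓ : ℝ)|)))) *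
            (11 * (classLocalHc (saddlePoint x y) 2 1 k (σ * (d₂ * a)) * (((e₂ : ℝ) ^ (-saddlePoint x y) * (x ^ saddlePoint x y * smoothZeta (saddlePoint x y) y /
            Real.sqrt (2 * Real.pi * saddlePhi₂ (saddlePoint x y) y))) * (∑' ℓ : ℤ, ‖c₂ ℓ‖ * (1 + |(ℓ : ℝ)|))))) *
            (11 * (classLocalHc (saddlePoint x y) 1 0 k a * (((e₃ : ℝ) ^ (-saddlePoint x y) * (x ^ saddlePoint x y * smoothZeta (saddlePoint x y) y /
            Real.sqrt (2 * Real.pi * saddlePhi₂ (saddlePoint x y) y))) * (∑' ℓ : ℤ, ‖c₃ ℓ‖ * (1 + |(ℓ : ℝ)|)))))) := by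
  -- ### positivity and the three scales
  set α : ℝ := saddlePoint x y with hα
  have hα0 : 0 < α := saddlePoint_pos hx hy
  have hx0 : 0 < x := by linarith
  have he₁0 : (0 : ℝ) < e₁ := by exact_mod_cast he₁
  have he₂0 : (0 : ℝ) < e₂ := by exact_mod_cast he₂
  have he₃0 : (0 : ℝ) < e₃ := by exact_mod_cast he₃
  have hX₁ : 1 ≤ x / e₁ := by rw [le_div_iff₀ he₁0, one_mul]; exact hex₁
  have hX₂ : 1 ≤ x / e₂ := by rw [le_div_iff₀ he₂0, one_mul]; exact hex₂
  have hX₃ : 1 ≤ x / e₃ := by rw [le_div_iff₀ he₃0, one_mul]; exact hex₃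
  have hM₀ : 0 ≤ x ^ α * smoothZeta α y / Real.sqrt (2 * Real.pi * saddlePhi₂ α y) :=
    div_nonneg (mul_nonneg (Real.rpow_nonneg hx0.le _) (smoothZeta_pos hα0).le) (Real.sqrt_nonneg _)
  have hMv₁ : 0 ≤ (e₁ : ℝ) ^ (-α) * (x ^ α * smoothZeta α y / Real.sqrt (2 * Real.pi * saddlePhi₂ α y)) :=
    mul_nonneg (Real.rpow_nonneg he₁0.le _) hM₀
  have hMv₂ : 0 ≤ (e₂ : ℝ) ^ (-α) * (x ^ α * smoothZeta α y / Real.sqrt (2 * Real.pi * saddlePhi₂ α y)) :=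
    mul_nonneg (Real.rpow_nonneg he₂0.le _) hM₀
  have hMv₃ : 0 ≤ (e₃ : ℝ) ^ (-α) * (x ^ α * smoothZeta α y / Real.sqrt (2 * Real.pi * saddlePhi₂ α y)) :=
    mul_nonneg (Real.rpow_nonneg he₃0.le _) hM₀
  have hS₁ : 0 ≤ (∑' ℓ : ℤ, ‖c₁ ℓ‖ * (1 + |(ℓ : ℝ)|)) := tsum_nonneg fun ℓ => by positivity
  have hS₂ : 0 ≤ (∑' ℓ : ℤ, ‖c₂ ℓ‖ * (1 + |(ℓ : ℝ)|)) := tsum_nonneg fun ℓ => by positivity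
  have hS₃ : 0 ≤ (∑' ℓ : ℤ, ‖c₃ ℓ‖ * (1 + |(ℓ : ℝ)|)) := tsum_nonneg fun ℓ => by positivity
  have h2S : 2 ∈ Nat.smoothNumbers (y + 1) := Nat.mem_smoothNumbers_of_lt two_pos (by omega)
  have h1S : 1 ∈ Nat.smoothNumbers (y + 1) := Nat.mem_smoothNumbers_of_lt one_pos (by omega)
  -- the scaling bounds `e · lcm(k, m)² ≤ E`
  have hl2 : Nat.lcm k 2 ≤ 2 * k := by
    rw [mul_comm]; exact Nat.le_of_dvd (by positivity) (Nat.lcm_dvd_mul k 2)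
  have hE₁' : ((e₁ * (Nat.lcm k 2) ^ 2 : ℕ) : ℝ) ≤ E :=
    le_trans (by exact_mod_cast Nat.mul_le_mul_left e₁ (Nat.pow_le_pow_left hl2 2)) hE₁
  have hE₂' : ((e₂ * (Nat.lcm k 2) ^ 2 : ℕ) : ℝ) ≤ E :=
    le_trans (by exact_mod_cast Nat.mul_le_mul_left e₂ (Nat.pow_le_pow_left hl2 2)) hE₂
  have hE₃' : ((e₃ * (Nat.lcm k 1) ^ 2 : ℕ) : ℝ) ≤ E := by rw [Nat.lcm_one_right]; exact hE₃
  -- the offsets `|λ_i| ≤ Λ/2`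
  have hβ0 : 0 ≤ |β| := abs_nonneg β
  have hβ₁ : |(d₁ : ℝ) * β * (x / e₁)| ≤ Λ / 2 := by
    rw [show (d₁ : ℝ) * β * (x / e₁) = β * ((d₁ : ℝ) * (x / e₁)) by ring, abs_mul,
      abs_of_nonneg (by positivity : (0 : ℝ) ≤ (d₁ : ℝ) * (x / e₁))]
    exact (mul_le_mul_of_nonneg_left hd₁ hβ0).trans hβ
  have hβ₂ : |(d₂ : ℝ) * β * (x / e₂)| ≤ Λ / 2 := by
    rw [show (d₂ : ℝ) * β * (x / e₂) = β * ((d₂ : ℝ) * (x / e₂)) by ring, abs_mul,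
      abs_of_nonneg (by positivity : (0 : ℝ) ≤ (d₂ : ℝ) * (x / e₂))]
    exact (mul_le_mul_of_nonneg_left hd₂ hβ0).trans hβ
  have hσabs : |(σ : ℝ)| = 1 := by rcases hσ with rfl | rfl <;> simp
  have hβ₂σ : |(σ : ℝ) * d₂ * β * (x / e₂)| = |(d₂ : ℝ) * β * (x / e₂)| := by
    rw [show (σ : ℝ) * d₂ * β * (x / e₂) = (σ : ℝ) * ((d₂ : ℝ) * β * (x / e₂)) by ring, abs_mul, hσabs, one_mul]
  have hβ₂' : |(σ : ℝ) * d₂ * β * (x / e₂)| ≤ Λ / 2 := hβ₂σ ▸ hβ₂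
  have hβ₃ : |β * (x / e₃)| ≤ Λ / 2 := by
    rw [abs_mul, abs_of_nonneg (by positivity : (0 : ℝ) ≤ x / e₃)]
    refine le_trans (mul_le_mul_of_nonneg_left ?_ hβ0) hβ
    exact div_le_self hx0.le (by exact_mod_cast he₃)
  -- ### the three one-variable bounds
  have hV₁ := classProfileSum_major_point hx hy hα1 hΛ hη0 hε₀ hC hW hF he₁ hex₁ (m := 2) (r := 1) (by norm_num) h2S
    hk hkS hE₁' ((d₁ : ℤ) * a) hc₁ hβ₁
  have hV₂ := classProfileSum_major_point hx hy hα1 hΛ hη0 hε₀ hC hW hF he₂ hex₂ (m := 2) (r := 1) (by norm_num) h2S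
    hk hkS hE₂' (σ * ((d₂ : ℤ) * a)) hc₂ hβ₂'
  have hV₃ := classProfileSum_major_point hx hy hα1 hΛ hη0 hε₀ hC hW hF he₃ hex₃ (m := 1) (r := 0) le_rfl h1S
    hk hkS hE₃' (a : ℤ) hc₃ hβ₃
  rw [← hα] at hV₁ hV₂ hV₃
  -- the angles
  have eθ₁ : (d₁ : ℝ) * ((a : ℝ) / k + β) = (((d₁ : ℤ) * a : ℤ) : ℝ) / k + (d₁ : ℝ) * β := by push_cast; ring
  have eθ₂ : (σ : ℝ) * d₂ * ((a : ℝ) / k + β) = ((σ * ((d₂ : ℤ) * a) : ℤ) : ℝ) / k + (σ : ℝ) * d₂ * β := by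
    push_cast; ring
  have eθ₃ : (a : ℝ) / k + β = ((a : ℤ) : ℝ) / k + β := by push_cast; ring
  rw [eθ₁, eθ₂, eθ₃]
  -- ### weaken and multiply
  have hk2 : (Nat.lcm k 2 : ℝ) ≤ (2 * k : ℝ) := by exact_mod_cast hl2
  have hk1 : (Nat.lcm k 1 : ℝ) ≤ (2 * k : ℝ) := by
    rw [Nat.lcm_one_right]; exact_mod_cast Nat.le_mul_of_pos_left k two_pos
  have hΛ2 : Λ / 2 ≤ Λ := by linarith
  refine norm_triple_sub_triple_le hη0 hη1 (by positivity) ?_ (by positivity) ?_ (by positivity) ?_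
    (mul_nonneg hMv₁ hS₁) (mul_nonneg hMv₂ hS₂) (mul_nonneg hMv₃ hS₃) ?_ ?_ ?_
    (norm_classLocalFactor_le hα0.le 2 1 k _) (norm_classLocalFactor_le hα0.le 2 1 k _)
    (norm_classLocalFactor_le hα0.le 1 0 k _)
    (norm_profileModelSum_le_inv_one_add hc₁ hMv₁ hX₁ hα0.le hα1 hΛ₁ hβ₁) ?_
    (norm_profileModelSum_le_inv_one_add hc₃ hMv₃ hX₃ hα0.le hα1 hΛ₃ hβ₃)
    (hV₁.trans (major_point_weaken hMv₁ (classLocalHc_nonneg α 2 1 k _) hS₁ (by linarith) (profileNorm_nonneg c₁)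
      (Nat.cast_nonneg _) hC (by positivity) hε₀.le (hβ₁.trans hΛ2) hk2))
    ?_
    (hV₃.trans (major_point_weaken hMv₃ (classLocalHc_nonneg α 1 0 k _) hS₃ (by linarith) (profileNorm_nonneg c₃)
      (Nat.cast_nonneg _) hC (by positivity) hε₀.le (hβ₃.trans hΛ2) hk1))
  · exact div_le_one_of_le₀ (by linarith [abs_nonneg ((d₁ : ℝ) * β * (x / e₁))]) (by positivity)
  · exact div_le_one_of_le₀ (by linarith [abs_nonneg ((d₂ : ℝ) * β * (x / e₂))]) (by positivity)
  · exact div_le_one_of_le₀ (by linarith [abs_nonneg (β * (x / e₃))]) (by positivity)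
  · exact major_point_flat_nonneg (classLocalHc_nonneg α 2 1 k _) hMv₁ hΛ hS₁ (by linarith) (profileNorm_nonneg c₁) (by positivity) hC
      (by positivity) (Nat.cast_nonneg _)
  · exact major_point_flat_nonneg (classLocalHc_nonneg α 2 1 k _) hMv₂ hΛ hS₂ (by linarith) (profileNorm_nonneg c₂) (by positivity) hC
      (by positivity) (Nat.cast_nonneg _)
  · exact major_point_flat_nonneg (classLocalHc_nonneg α 1 0 k _) hMv₃ hΛ hS₃ (by linarith) (profileNorm_nonneg c₃) (by positivity) hC
      (by positivity) (Nat.cast_nonneg _)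
  · have h := norm_profileModelSum_le_inv_one_add hc₂ hMv₂ hX₂ hα0.le hα1 hΛ₂ hβ₂'
    rwa [hβ₂σ] at h
  · have h := hV₂.trans (major_point_weaken hMv₂ (classLocalHc_nonneg α 2 1 k _) hS₂ (by linarith)
      (profileNorm_nonneg c₂) (Nat.cast_nonneg _) hC (by positivity) hε₀.le (hβ₂'.trans hΛ2) hk2)
    rwa [hβ₂σ] at h

end SmoothArcs

end Literature.NumberTheory.Sieve

end
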